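import Mathlib
import Summits.MatrixMultiplication.MatrixMultiplication.Theses.HiddenToeplitzCorners
import Literature.Computability.AlgebraicComplexity.ArithCircuitProofs
import Literature.Computability.AlgebraicComplexity.MatMulTotalComplexityProofs
import Literature.Computability.AlgebraicComplexity.FastFourierTransform
import Literature.Computability.AlgebraicComplexity.DivisionSLP
import Literature.LinearAlgebra.Matrix.CauchyDeterminant
import Literature.LinearAlgebra.Matrix.CauchyLike

/-!
# Stub `stub_pencilPad2` of crux `HiddenToeplitzCorners.ToeplitzLikeDetCost` (stmt-MatrixMultiplication-7491),
# line `Sketch`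

The pencil over R = ℂ[X]: Stein equation, linear-form program of length s, entrywise evaluation.

Target tree file: `Summits/MatrixMultiplication/MatrixMultiplication/Theorems/HiddenToeplitzCornersToeplitzLikeDetCostPencilPad2.lean`
(helper for the crux, landed with `--supports stmt-MatrixMultiplication-7491`). The theorem `stub_pencilPad2`
below must keep EXACTLY this name and signature (it is registered on the crux).
-/

set_option linter.dupNamespace false

namespace Summit.MatrixMultiplication.MatrixMultiplication.Theorems

open scoped BigOperators Matrix
open Literature.Computability.AlgebraicComplexity Literature.LinearAlgebra.Matrix
open Literature.Computability.AlgebraicComplexity.ArithCircuit (FanInTwoSeq freeInputs)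
open Summit.MatrixMultiplication.MatrixMultiplication.Theses.HiddenToeplitzCorners (ToeplitzLikeDetCost)

noncomputable section

/-! #### (P5): entrywise evaluation of a pencil -/

/-- Entrywise evaluation of a matrix pencil `∑_{a,b} X_{ab} • M_{ab}` at a point `x`:
the result is `∑_{a,b} x_{ab} • M_{ab}`. [folklore] -/
theorem pencilPad2_eval_pencil (r : ℕ) (m m' : Type) [Fintype m] [Fintype m']
    (M : Fin r → Fin r → Matrix m m' ℂ) (x : Fin r × Fin r → ℂ) :
    (∑ a : Fin r, ∑ b : Fin r, (MvPolynomial.X (a, b) : MvPolynomial (Fin r × Fin r) ℂ) •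
        (M a b).map (MvPolynomial.C : ℂ → MvPolynomial (Fin r × Fin r) ℂ)).map (MvPolynomial.eval x) =
      ∑ a : Fin r, ∑ b : Fin r, x (a, b) • M a b := by
  have _hm : Fintype m := inferInstance
  have _hm' : Fintype m' := inferInstance
  ext i j
  simp [Matrix.sum_apply, MvPolynomial.eval_X, MvPolynomial.eval_C, smul_eq_mul]

/-! #### (P3): the Stein equation of the pencil over `R = ℂ[X]` -/

/-- The lower shift matrix over `ℂ` maps to the lower shift matrix over `ℂ[X]` under `C`.
[folklore] -/
theorem pencilPad2_shift_map (r N : ℕ) :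
    (Matrix.of fun i j : Fin N => if (i : ℕ) = (j : ℕ) + 1 then (1 : ℂ) else 0).map
        (MvPolynomial.C : ℂ → MvPolynomial (Fin r × Fin r) ℂ) =
      Matrix.of fun i j : Fin N => if (i : ℕ) = (j : ℕ) + 1 then (1 : MvPolynomial (Fin r × Fin r) ℂ) else 0 := by
  ext i j
  simp only [Matrix.map_apply, Matrix.of_apply]
  split_ifs <;> simp

/-- One Stein equation `T - Z T Zᵀ = G₀ H₁ᵀ + G₁ H₀ᵀ` over `ℂ`, mapped coefficientwise into `ℂ[X]`.
[folklore] -/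
theorem pencilPad2_stein_map (r N d : ℕ) (T : Matrix (Fin N) (Fin N) ℂ)
    (G₀ H₀ G₁ H₁ : Matrix (Fin N) (Fin d) ℂ)
    (hT : T - (Matrix.of fun i j : Fin N => if (i : ℕ) = (j : ℕ) + 1 then (1 : ℂ) else 0) * T *
        (Matrix.of fun i j : Fin N => if (i : ℕ) = (j : ℕ) + 1 then (1 : ℂ) else 0)ᵀ = G₀ * H₁ᵀ + G₁ * H₀ᵀ) :
    T.map (MvPolynomial.C : ℂ → MvPolynomial (Fin r × Fin r) ℂ) -
        (Matrix.of fun i j : Fin N => if (i : ℕ) = (j : ℕ) + 1 then (1 : MvPolynomial (Fin r × Fin r) ℂ) else 0) *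
          T.map (MvPolynomial.C : ℂ → MvPolynomial (Fin r × Fin r) ℂ) *
          (Matrix.of fun i j : Fin N => if (i : ℕ) = (j : ℕ) + 1 then (1 : MvPolynomial (Fin r × Fin r) ℂ) else 0)ᵀ =
      G₀.map (MvPolynomial.C : ℂ → MvPolynomial (Fin r × Fin r) ℂ) *
          (H₁.map (MvPolynomial.C : ℂ → MvPolynomial (Fin r × Fin r) ℂ))ᵀ +
        G₁.map (MvPolynomial.C : ℂ → MvPolynomial (Fin r × Fin r) ℂ) *
          (H₀.map (MvPolynomial.C : ℂ → MvPolynomial (Fin r × Fin r) ℂ))ᵀ := by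
  have h := congrArg (fun M : Matrix (Fin N) (Fin N) ℂ => M.map (MvPolynomial.C : ℂ → MvPolynomial (Fin r × Fin r) ℂ)) hT
  rw [Matrix.map_sub _ (map_sub _), Matrix.map_add _ (map_add _), Matrix.map_mul, Matrix.map_mul,
    Matrix.map_mul, Matrix.map_mul, Matrix.transpose_map, Matrix.transpose_map, Matrix.transpose_map,
    pencilPad2_shift_map] at h
  exact h

/-- **(P3)** The per-`(a,b)` Stein equations assemble into one Stein equation for the pencil
`T(X) = ∑ X_{ab} T_{ab}` over `R = ℂ[X]`, with generators `(G₀ | G₁(X))` and `(H₁(X) | H₀)`.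
[folklore] -/
theorem pencilPad2_stein (r N d : ℕ) (T : Fin r → Fin r → Matrix (Fin N) (Fin N) ℂ)
    (G₀ H₀ : Matrix (Fin N) (Fin d) ℂ) (G₁ H₁ : Fin r → Fin r → Matrix (Fin N) (Fin d) ℂ)
    (hT : ∀ a b, T a b - (Matrix.of fun i j : Fin N => if (i : ℕ) = (j : ℕ) + 1 then (1 : ℂ) else 0) * T a b *
        (Matrix.of fun i j : Fin N => if (i : ℕ) = (j : ℕ) + 1 then (1 : ℂ) else 0)ᵀ = G₀ * (H₁ a b)ᵀ + G₁ a b * H₀ᵀ) :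
    (∑ a : Fin r, ∑ b : Fin r, (MvPolynomial.X (a, b) : MvPolynomial (Fin r × Fin r) ℂ) •
          (T a b).map (MvPolynomial.C : ℂ → MvPolynomial (Fin r × Fin r) ℂ)) -
        (Matrix.of fun i j : Fin N => if (i : ℕ) = (j : ℕ) + 1 then (1 : MvPolynomial (Fin r × Fin r) ℂ) else 0) *
          (∑ a : Fin r, ∑ b : Fin r, (MvPolynomial.X (a, b) : MvPolynomial (Fin r × Fin r) ℂ) •
            (T a b).map (MvPolynomial.C : ℂ → MvPolynomial (Fin r × Fin r) ℂ)) *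
          (Matrix.of fun i j : Fin N => if (i : ℕ) = (j : ℕ) + 1 then (1 : MvPolynomial (Fin r × Fin r) ℂ) else 0)ᵀ =
      (Matrix.fromCols (G₀.map (MvPolynomial.C : ℂ → MvPolynomial (Fin r × Fin r) ℂ))
          (∑ a : Fin r, ∑ b : Fin r, (MvPolynomial.X (a, b) : MvPolynomial (Fin r × Fin r) ℂ) •
            (G₁ a b).map (MvPolynomial.C : ℂ → MvPolynomial (Fin r × Fin r) ℂ))) *
        (Matrix.fromCols
          (∑ a : Fin r, ∑ b : Fin r, (MvPolynomial.X (a, b) : MvPolynomial (Fin r × Fin r) ℂ) •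
            (H₁ a b).map (MvPolynomial.C : ℂ → MvPolynomial (Fin r × Fin r) ℂ))
          (H₀.map (MvPolynomial.C : ℂ → MvPolynomial (Fin r × Fin r) ℂ)))ᵀ := by
  have key := fun a b => pencilPad2_stein_map r N d (T a b) G₀ H₀ (G₁ a b) (H₁ a b) (hT a b)
  set Z : Matrix (Fin N) (Fin N) (MvPolynomial (Fin r × Fin r) ℂ) :=
    Matrix.of fun i j : Fin N => if (i : ℕ) = (j : ℕ) + 1 then (1 : MvPolynomial (Fin r × Fin r) ℂ) else 0 with hZ
  calc _ = ∑ a : Fin r, ∑ b : Fin r, (MvPolynomial.X (a, b) : MvPolynomial (Fin r × Fin r) ℂ) •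
          ((T a b).map (MvPolynomial.C : ℂ → MvPolynomial (Fin r × Fin r) ℂ) -
            Z * (T a b).map (MvPolynomial.C : ℂ → MvPolynomial (Fin r × Fin r) ℂ) * Zᵀ) := by
        simp only [smul_sub, Finset.sum_sub_distrib, Finset.mul_sum, Finset.sum_mul, mul_smul_comm,
          smul_mul_assoc]
    _ = ∑ a : Fin r, ∑ b : Fin r, (MvPolynomial.X (a, b) : MvPolynomial (Fin r × Fin r) ℂ) •
          (G₀.map (MvPolynomial.C : ℂ → MvPolynomial (Fin r × Fin r) ℂ) *
              ((H₁ a b).map (MvPolynomial.C : ℂ → MvPolynomial (Fin r × Fin r) ℂ))ᵀ +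
            (G₁ a b).map (MvPolynomial.C : ℂ → MvPolynomial (Fin r × Fin r) ℂ) *
              (H₀.map (MvPolynomial.C : ℂ → MvPolynomial (Fin r × Fin r) ℂ))ᵀ) := by
        simp only [key]
    _ = _ := by
        rw [Matrix.transpose_fromCols, Matrix.fromCols_mul_fromRows]
        simp only [smul_add, Finset.sum_add_distrib, Matrix.transpose_sum, Matrix.transpose_smul,
          Matrix.mul_sum, Matrix.sum_mul, Matrix.mul_smul, Matrix.smul_mul]

/-! #### (P4): the linear forms `G₁(X)`, `H₁(X)` cost `s` gates -/

/-- A linear form `∑_p w_p X_p` is computed from the free inputs by as many fan-in-two sum gates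
as it has nonzero coefficients (none if it vanishes: then it is the free input `0`).
[folklore] -/
theorem pencilPad2_linForm_chain {σ : Type} [Fintype σ] (w : σ → ℂ) :
    ∃ ch : List (MvPolynomial σ ℂ), FanInTwoSeq (freeInputs ℂ σ) ch ∧
      ch.length = (Finset.univ.filter fun p => w p ≠ 0).card ∧
      (∑ p, w p • (MvPolynomial.X p : MvPolynomial σ ℂ)) ∈ freeInputs ℂ σ ∪ {x | x ∈ ch} := by
  set s : Finset σ := Finset.univ.filter fun p => w p ≠ 0 with hs
  have hsum : (∑ p, w p • (MvPolynomial.X p : MvPolynomial σ ℂ)) =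
      ∑ p ∈ s, w p • (MvPolynomial.X p : MvPolynomial σ ℂ) := by
    refine (Finset.sum_subset (Finset.subset_univ s) fun p _ hp => ?_).symm
    have hw : w p = 0 := by
      by_contra h
      exact hp (Finset.mem_filter.2 ⟨Finset.mem_univ p, h⟩)
    rw [hw, zero_smul]
  by_cases hne : s.Nonempty
  · obtain ⟨ch, hlen, hch, hmem⟩ := ArithCircuit.FanInTwoSeq.exists_chain_sum s w
      (fun p => (MvPolynomial.X p : MvPolynomial σ ℂ)) ArithCircuit.zero_mem_freeInputs
      (fun p _ => ArithCircuit.X_mem_freeInputs p) hne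
    exact ⟨ch, hch, hlen, by rw [hsum]; exact Or.inr hmem⟩
  · rw [Finset.not_nonempty_iff_eq_empty] at hne
    refine ⟨[], trivial, by rw [hne]; rfl, ?_⟩
    rw [hsum, hne, Finset.sum_empty]
    exact Or.inl ArithCircuit.zero_mem_freeInputs

/-- Independent programs for a finite family of targets concatenate into one program over the
same available set, of total length the sum of the lengths, after which every target is available.
[folklore] -/
theorem pencilPad2_family {σ ι : Type} [Fintype ι] (A : Set (MvPolynomial σ ℂ)) (n : ι → ℕ)
    (v : ι → MvPolynomial σ ℂ)
    (h : ∀ i, ∃ ch : List (MvPolynomial σ ℂ), FanInTwoSeq A ch ∧ ch.length = n i ∧ v i ∈ A ∪ {x | x ∈ ch}) :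
    ∃ l : List (MvPolynomial σ ℂ), FanInTwoSeq A l ∧ l.length = ∑ i, n i ∧ ∀ i, v i ∈ A ∪ {x | x ∈ l} := by
  choose ch hch hlen hmem using h
  refine ⟨(Finset.univ.toList.map ch).flatten, ArithCircuit.FanInTwoSeq.flatten ?_, ?_, ?_⟩
  · intro b hb
    obtain ⟨i, -, rfl⟩ := List.mem_map.1 hb
    exact hch i
  · rw [List.length_flatten, List.map_map, Finset.sum_map_toList]
    exact Finset.sum_congr rfl fun i _ => hlen i
  · intro i
    rcases hmem i with h | h
    · exact Or.inl h
    · refine Or.inr ?_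
      simp only [Set.mem_setOf_eq, List.mem_flatten, List.mem_map]
      exact ⟨ch i, ⟨i, Finset.mem_toList.2 (Finset.mem_univ i), rfl⟩, h⟩

/-- The entries of a pencil of matrices with constant coefficients are linear forms in the
variables. [folklore] -/
theorem pencilPad2_pencil_entry (r N d : ℕ) (F : Fin r → Fin r → Matrix (Fin N) (Fin d) ℂ) (i : Fin N) (k : Fin d) :
    (∑ a : Fin r, ∑ b : Fin r, (MvPolynomial.X (a, b) : MvPolynomial (Fin r × Fin r) ℂ) •
        (F a b).map (MvPolynomial.C : ℂ → MvPolynomial (Fin r × Fin r) ℂ)) i k =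
      ∑ p : Fin r × Fin r, F p.1 p.2 i k • (MvPolynomial.X p : MvPolynomial (Fin r × Fin r) ℂ) := by
  simp only [Matrix.sum_apply, Matrix.smul_apply, Matrix.map_apply, smul_eq_mul, Fintype.sum_prod_type,
    MvPolynomial.smul_eq_C_mul]
  exact Finset.sum_congr rfl fun a _ => Finset.sum_congr rfl fun b _ => mul_comm _ _

/-- Counting the nonzero coefficients of a pencil entrywise or coefficientwise gives the same
sparsity. [folklore] -/
theorem pencilPad2_count (r N d : ℕ) (F : Fin r → Fin r → Matrix (Fin N) (Fin d) ℂ) :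
    ∑ q : Fin N × Fin d, (Finset.univ.filter fun p : Fin r × Fin r => F p.1 p.2 q.1 q.2 ≠ 0).card =
      ∑ a : Fin r, ∑ b : Fin r, (Finset.univ.filter fun q : Fin N × Fin d => F a b q.1 q.2 ≠ 0).card := by
  simp only [Finset.card_filter]
  conv_lhs => rw [Finset.sum_comm]
  rw [Fintype.sum_prod_type]

/-- The entries of one pencil `F(X) = ∑ X_{ab} F_{ab}` are computed from the free inputs by a
fan-in-two program of length the sparsity `∑_{ab} #{F_{ab} ≠ 0}`. [folklore] -/
theorem pencilPad2_pencil_program (r N d : ℕ) (F : Fin r → Fin r → Matrix (Fin N) (Fin d) ℂ) :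
    ∃ l : List (MvPolynomial (Fin r × Fin r) ℂ), FanInTwoSeq (freeInputs ℂ (Fin r × Fin r)) l ∧
      l.length = (∑ a : Fin r, ∑ b : Fin r, (Finset.univ.filter fun p : Fin N × Fin d => F a b p.1 p.2 ≠ 0).card) ∧
      (∀ i k, (∑ a : Fin r, ∑ b : Fin r, (MvPolynomial.X (a, b) : MvPolynomial (Fin r × Fin r) ℂ) •
        (F a b).map (MvPolynomial.C : ℂ → MvPolynomial (Fin r × Fin r) ℂ)) i k ∈
          freeInputs ℂ (Fin r × Fin r) ∪ {x | x ∈ l}) := by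
  obtain ⟨l, hl, hlen, hmem⟩ := pencilPad2_family (freeInputs ℂ (Fin r × Fin r))
    (fun q : Fin N × Fin d => (Finset.univ.filter fun p : Fin r × Fin r => F p.1 p.2 q.1 q.2 ≠ 0).card)
    (fun q : Fin N × Fin d => ∑ p : Fin r × Fin r, F p.1 p.2 q.1 q.2 • (MvPolynomial.X p : MvPolynomial (Fin r × Fin r) ℂ))
    (fun q => pencilPad2_linForm_chain fun p : Fin r × Fin r => F p.1 p.2 q.1 q.2)
  refine ⟨l, hl, by rw [hlen, pencilPad2_count], fun i k => ?_⟩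
  rw [pencilPad2_pencil_entry]
  exact hmem (i, k)

/-- **(P4)** The linear forms `G₁(X)` and `H₁(X)` are computed from the free inputs by a
fan-in-two program of length at most the sparsity `s = ∑_{ab} (#{G₁,ab ≠ 0} + #{H₁,ab ≠ 0})`.
[folklore] -/
theorem pencilPad2_program (r N d : ℕ) (G₁ H₁ : Fin r → Fin r → Matrix (Fin N) (Fin d) ℂ) :
    ∃ l : List (MvPolynomial (Fin r × Fin r) ℂ), FanInTwoSeq (freeInputs ℂ (Fin r × Fin r)) l ∧
      l.length ≤ (∑ a : Fin r, ∑ b : Fin r, ((Finset.univ.filter fun p : Fin N × Fin d => G₁ a b p.1 p.2 ≠ 0).card +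
        (Finset.univ.filter fun p : Fin N × Fin d => H₁ a b p.1 p.2 ≠ 0).card)) ∧
      (∀ i k, (∑ a : Fin r, ∑ b : Fin r, (MvPolynomial.X (a, b) : MvPolynomial (Fin r × Fin r) ℂ) •
        (G₁ a b).map (MvPolynomial.C : ℂ → MvPolynomial (Fin r × Fin r) ℂ)) i k ∈
          freeInputs ℂ (Fin r × Fin r) ∪ {x | x ∈ l}) ∧
      (∀ i k, (∑ a : Fin r, ∑ b : Fin r, (MvPolynomial.X (a, b) : MvPolynomial (Fin r × Fin r) ℂ) •
        (H₁ a b).map (MvPolynomial.C : ℂ → MvPolynomial (Fin r × Fin r) ℂ)) i k ∈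
          freeInputs ℂ (Fin r × Fin r) ∪ {x | x ∈ l}) := by
  obtain ⟨lG, hG, hlenG, hmemG⟩ := pencilPad2_pencil_program r N d G₁
  obtain ⟨lH, hH, hlenH, hmemH⟩ := pencilPad2_pencil_program r N d H₁
  refine ⟨lG ++ lH, hG.append (hH.mono Set.subset_union_right), ?_, fun i k => ?_, fun i k => ?_⟩
  · rw [List.length_append, hlenG, hlenH]
    simp only [Finset.sum_add_distrib, le_refl]
  · rcases hmemG i k with h | h
    · exact Or.inl h
    · exact Or.inr (List.mem_append_left lH h)
  · rcases hmemH i k with h | h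
    · exact Or.inl h
    · exact Or.inr (List.mem_append_right lG h)

/-- **Stub `pencilPad2`** — see `Lines/Sketch.lean`. [folklore] -/
theorem stub_pencilPad2 :
    (∀ (r N d : ℕ) (T : Fin r → Fin r → Matrix (Fin N) (Fin N) ℂ) (G₀ H₀ : Matrix (Fin N) (Fin d) ℂ) (G₁ H₁ : Fin r → Fin r → Matrix (Fin N) (Fin d) ℂ),
        (∀ a b, T a b - (Matrix.of fun i j : Fin N => if (i : ℕ) = (j : ℕ) + 1 then (1 : ℂ) else 0) * T a b * (Matrix.of fun i j : Fin N => if (i : ℕ) = (j : ℕ) + 1 then (1 : ℂ) else 0)ᵀ = G₀ * (H₁ a b)ᵀ + G₁ a b * H₀ᵀ) →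
        (∑ a : Fin r, ∑ b : Fin r, (MvPolynomial.X (a, b) : MvPolynomial (Fin r × Fin r) ℂ) • (T a b).map (MvPolynomial.C : ℂ → MvPolynomial (Fin r × Fin r) ℂ)) -
          (Matrix.of fun i j : Fin N => if (i : ℕ) = (j : ℕ) + 1 then (1 : MvPolynomial (Fin r × Fin r) ℂ) else 0) *
          (∑ a : Fin r, ∑ b : Fin r, (MvPolynomial.X (a, b) : MvPolynomial (Fin r × Fin r) ℂ) • (T a b).map (MvPolynomial.C : ℂ → MvPolynomial (Fin r × Fin r) ℂ)) *
          (Matrix.of fun i j : Fin N => if (i : ℕ) = (j : ℕ) + 1 then (1 : MvPolynomial (Fin r × Fin r) ℂ) else 0)ᵀ =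
          (Matrix.fromCols (G₀.map (MvPolynomial.C : ℂ → MvPolynomial (Fin r × Fin r) ℂ)) (∑ a : Fin r, ∑ b : Fin r, (MvPolynomial.X (a, b) : MvPolynomial (Fin r × Fin r) ℂ) • (G₁ a b).map (MvPolynomial.C : ℂ → MvPolynomial (Fin r × Fin r) ℂ))) *
          (Matrix.fromCols (∑ a : Fin r, ∑ b : Fin r, (MvPolynomial.X (a, b) : MvPolynomial (Fin r × Fin r) ℂ) • (H₁ a b).map (MvPolynomial.C : ℂ → MvPolynomial (Fin r × Fin r) ℂ)) (H₀.map (MvPolynomial.C : ℂ → MvPolynomial (Fin r × Fin r) ℂ)))ᵀ) ∧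
    (∀ (r N d : ℕ) (T : Fin r → Fin r → Matrix (Fin N) (Fin N) ℂ) (G₀ H₀ : Matrix (Fin N) (Fin d) ℂ) (G₁ H₁ : Fin r → Fin r → Matrix (Fin N) (Fin d) ℂ),
        ∃ l : List (MvPolynomial (Fin r × Fin r) ℂ), FanInTwoSeq (freeInputs ℂ (Fin r × Fin r)) l ∧
          l.length ≤ (∑ a : Fin r, ∑ b : Fin r, ((Finset.univ.filter fun p : Fin N × Fin d => G₁ a b p.1 p.2 ≠ 0).card + (Finset.univ.filter fun p : Fin N × Fin d => H₁ a b p.1 p.2 ≠ 0).card)) ∧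
          (∀ i k, (∑ a : Fin r, ∑ b : Fin r, (MvPolynomial.X (a, b) : MvPolynomial (Fin r × Fin r) ℂ) • (G₁ a b).map (MvPolynomial.C : ℂ → MvPolynomial (Fin r × Fin r) ℂ)) i k ∈ freeInputs ℂ (Fin r × Fin r) ∪ {x | x ∈ l}) ∧
          (∀ i k, (∑ a : Fin r, ∑ b : Fin r, (MvPolynomial.X (a, b) : MvPolynomial (Fin r × Fin r) ℂ) • (H₁ a b).map (MvPolynomial.C : ℂ → MvPolynomial (Fin r × Fin r) ℂ)) i k ∈ freeInputs ℂ (Fin r × Fin r) ∪ {x | x ∈ l})) ∧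
    (∀ (r : ℕ) (m m' : Type) [Fintype m] [Fintype m'] (M : Fin r → Fin r → Matrix m m' ℂ) (x : Fin r × Fin r → ℂ),
        (∑ a : Fin r, ∑ b : Fin r, (MvPolynomial.X (a, b) : MvPolynomial (Fin r × Fin r) ℂ) • (M a b).map (MvPolynomial.C : ℂ → MvPolynomial (Fin r × Fin r) ℂ)).map (MvPolynomial.eval x) =
          ∑ a : Fin r, ∑ b : Fin r, x (a, b) • M a b) := by
  refine ⟨fun r N d T G₀ H₀ G₁ H₁ hT => pencilPad2_stein r N d T G₀ H₀ G₁ H₁ hT,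
    fun r N d _ _ _ G₁ H₁ => pencilPad2_program r N d G₁ H₁, ?_⟩
  intro r m m' _ _ M x
  exact pencilPad2_eval_pencil r m m' M x

end

end Summit.MatrixMultiplication.MatrixMultiplication.Theorems
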